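import Literature.AlgebraicGeometry.Pohlmann1968.HodgeClassesCMAlgebra
import Mathlib.Data.Finset.Sum
import Mathlib.FieldTheory.PrimitiveElement
import HarnessLib

/-!
# Balanced weights of two CM families with independent Galois actions split into balanced blocks

Family `hodge`, layer `Literature/AlgebraicGeometry/Pohlmann1968`; written for the cell `pub-hodgecm2` (COR-CM,
count-neutral own-lane brick of seat b25) as the second set-up file of
`Pohlmann1968/HodgeClassesProductSpanCMProducts` (module docstring there).  Setting of
`Pohlmann1968/HodgeClassesCMAlgebra`: two finite families of number fields `K_i` (`i < n`), `K'_j` (`j < m`) with CM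
types `Φ_i`, `Φ'_j`; the glued index set `(⊔_i Hom(K_i, ℂ)) ⊔ (⊔_j Hom(K'_j, ℂ))` is the sum of the two sigma types,
on which `Aut(ℂ)` acts by composition.  Theorems only; no definition, no named fact, no `sorry`.

* §1 `exists_separating_pair` — integral elements `a_i ∈ 𝓞_{K_i}`, `a'_j ∈ 𝓞_{K'_j}` whose joint weight characters
  `∏_{(i,σ) ∈ S₁} σ(a_i) · ∏_{(j,σ') ∈ S₂} σ'(a'_j)` separate ALL finite `S = S₁ ⊔ S₂` of the glued index set (the
  separating element of the proof of Pohlmann's theorem for the CM algebra `∏ K_i × ∏ K'_j`: a primitive integral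
  element per field, slot shifts `k·M` over the `n + m` slots, a common shift `N` avoiding finitely many roots);
* §2 `exists_pohlmannSetsAlg_toLeft_toRight` — THE COMBINATORIAL HEART: if `Aut(ℂ)` acts blockwise independently
  (every `τ` agrees on all `Hom(K_i, ℂ)` with some `τ₁` fixing all `Hom(K'_j, ℂ)`), a weight `S` of the glued CM pair
  satisfying Gao–Ullmo's condition (3.2) with value `p` splits into balanced blocks:
  `S.toLeft ∈ pohlmannSetsAlg Φ p₁`, `S.toRight ∈ pohlmannSetsAlg Φ' p₂`, `p₁ + p₂ = p`.  Proof: test the condition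
  at `τ₁` (the second block then contributes its count at `τ = 1`) and at complex conjugation, using only the CM-type
  axiom `φ ∈ Φ ↔ φ̄ ∉ Φ`; the arithmetic is isolated in a private lemma.  This is the weight-by-weight content of
  `Hg(X × Y) = Hg(X) × Hg(Y)` for CM factors with independent Galois actions (Gordon 1999 §3, after Imai and Murty:
  "since the fields are distinct there is some `σ ∈ 𝒢` that acts as … on `X(K_{1,1}^×)` and trivially on the other
  components").

## References
* [MoonenZarhin1999LowDim] B. Moonen, Yu. Zarhin, Math. Ann. 315 (1999) 711–733, §3 (3.1).
* [GaoUllmo2025] Z. Gao, E. Ullmo, J. Inst. Math. Jussieu 25 (2025), §2.1 and Thm. 3.1 (3.2) (Pohlmann's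
  condition for a CM algebra) with proof.
* [Gordon1999HodgeAVSurvey] B. B. Gordon, *A survey of the Hodge conjecture for abelian varieties*, §3 Theorem
  (Imai, Murty) with proof; §9.2 (Pohlmann's theorem, proof).
-/

noncomputable section

open NumberField

namespace Literature.AlgebraicGeometry.Pohlmann1968

open Literature.AlgebraicGeometry.Motives (CMType)

/-! ### §1 A jointly separating pair of integral families for two families of number fields -/

section Separating

open Polynomial in
/-- An integral element of a number field separating its complex embeddings (a multiple of a primitive element).
[folklore] -/
private theorem exists_integral_separating (L : Type) [Field L] [NumberField L] :
    ∃ a : 𝓞 L, Function.Injective fun σ : L →+* ℂ => σ (a : L) := by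
  obtain ⟨α, hα⟩ := Field.exists_primitive_element ℚ L
  have hinjα : Function.Injective fun φ : L →ₐ[ℚ] ℂ => φ α :=
    (Field.primitive_element_iff_algHom_eq_of_eval' ℚ ℂ (fun x => IsAlgClosed.splits _) α).1 hα
  have hαℤ : IsAlgebraic ℤ α :=
    (IsFractionRing.isAlgebraic_iff ℤ ℚ L).2 (Algebra.IsAlgebraic.isAlgebraic α)
  obtain ⟨m, a, hm, hma⟩ := hαℤ.exists_nsmul_eq (𝓞 L)
  refine ⟨a, fun σ σ' h => ?_⟩
  have h' : σ α = σ' α := by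
    have hσ : σ (a : L) = (m : ℂ) * σ α := by
      rw [show ((a : 𝓞 L) : L) = m • α from hma.symm, nsmul_eq_mul, map_mul, map_natCast]
    have hσ' : σ' (a : L) = (m : ℂ) * σ' α := by
      rw [show ((a : 𝓞 L) : L) = m • α from hma.symm, nsmul_eq_mul, map_mul, map_natCast]
    have hh : (m : ℂ) * σ α = (m : ℂ) * σ' α := by rw [← hσ, ← hσ']; exact h
    exact mul_left_cancel₀ (Nat.cast_ne_zero.2 hm) hh
  have h'' := hinjα (show (fun φ : L →ₐ[ℚ] ℂ => φ α) σ.toRatAlgHom =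
    (fun φ : L →ₐ[ℚ] ℂ => φ α) σ'.toRatAlgHom from h')
  rw [← RingHom.toRatAlgHom_toRingHom σ, ← RingHom.toRatAlgHom_toRingHom σ', h'']

open Polynomial in
/-- **A jointly separating pair of integral families**: for two finite families of number fields `K_i`, `K'_j`
there are `a = (a_i) ∈ ∏ 𝓞_{K_i}`, `a' = (a'_j) ∈ ∏ 𝓞_{K'_j}` whose joint weight characters
`∏_{(i,σ) ∈ S₁} σ(a_i) · ∏_{(j,σ') ∈ S₂} σ'(a'_j)` are pairwise distinct over ALL finite
`S = S₁ ⊔ S₂ ⊆ (⊔_i Hom(K_i, ℂ)) ⊔ (⊔_j Hom(K'_j, ℂ))` (separating integral elements per field, slot shifts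
`k·M` over the `n + m` slots, and a common shift `N` avoiding finitely many roots — the argument of
`HodgeClassesCMAlgebra`'s separating family on the disjoint union of the two index sets) — the "generator with
pairwise distinct eigenvalues on the weight spaces" of the proof of Pohlmann's theorem, for the CM algebra
`∏ K_i × ∏ K'_j`. [cite: Gordon1999HodgeAVSurvey, §9.2 (proof of Theorem [B.88] Thm. 1: a separating element)]
[cite: GaoUllmo2025, proof of Thm. 3.1] -/
theorem exists_separating_pair {n m : ℕ} (K : Fin n → Type) (K' : Fin m → Type)
    [∀ i, Field (K i)] [∀ i, NumberField (K i)] [∀ j, Field (K' j)] [∀ j, NumberField (K' j)] :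
    ∃ (a : ∀ i, 𝓞 (K i)) (a' : ∀ j, 𝓞 (K' j)), Function.Injective
      fun S : Finset (((i : Fin n) × (K i →+* ℂ)) ⊕ ((j : Fin m) × (K' j →+* ℂ))) =>
        ∏ z ∈ S, Sum.elim (fun x : (i : Fin n) × (K i →+* ℂ) => x.2 ((a x.1 : 𝓞 (K x.1)) : K x.1))
          (fun y : (j : Fin m) × (K' j →+* ℂ) => y.2 ((a' y.1 : 𝓞 (K' y.1)) : K' y.1)) z := by
  classical
  have hex : ∀ i, ∃ a : 𝓞 (K i), Function.Injective fun σ : K i →+* ℂ => σ (a : K i) :=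
    fun i => exists_integral_separating (K i)
  have hex' : ∀ j, ∃ a : 𝓞 (K' j), Function.Injective fun σ : K' j →+* ℂ => σ (a : K' j) :=
    fun j => exists_integral_separating (K' j)
  choose a₀ hinja using hex
  choose a₀' hinja' using hex'
  -- the slot number and the base character of a point of the glued index set
  let slot : (((i : Fin n) × (K i →+* ℂ)) ⊕ ((j : Fin m) × (K' j →+* ℂ))) → ℕ :=
    Sum.elim (fun x => (x.1 : ℕ)) (fun y => n + (y.1 : ℕ))
  let base : (((i : Fin n) × (K i →+* ℂ)) ⊕ ((j : Fin m) × (K' j →+* ℂ))) → ℂ :=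
    Sum.elim (fun x => x.2 ((a₀ x.1 : 𝓞 (K x.1)) : K x.1)) (fun y => y.2 ((a₀' y.1 : 𝓞 (K' y.1)) : K' y.1))
  have hkey : ∀ z z', slot z = slot z' → base z = base z' → z = z' := by
    rintro (⟨i, σ⟩ | ⟨j, σ⟩) (⟨i', σ'⟩ | ⟨j', σ'⟩) hsl hb
    · simp only [slot, Sum.elim_inl] at hsl
      have hii : i = i' := Fin.ext hsl
      subst hii
      simp only [base, Sum.elim_inl] at hb
      rw [hinja i hb]
    · exfalso
      simp only [slot, Sum.elim_inl, Sum.elim_inr] at hsl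
      have := i.2
      omega
    · exfalso
      simp only [slot, Sum.elim_inl, Sum.elim_inr] at hsl
      have := i'.2
      omega
    · simp only [slot, Sum.elim_inr] at hsl
      have hjj : j = j' := Fin.ext (by omega)
      subst hjj
      simp only [base, Sum.elim_inr] at hb
      rw [hinja' j hb]
  -- slot shifts `slot·M` making `z ↦ base z + slot z · M` injective
  set bad₁ : Finset ℂ :=
    (Finset.univ : Finset ((((i : Fin n) × (K i →+* ℂ)) ⊕ ((j : Fin m) × (K' j →+* ℂ))) ×
      (((i : Fin n) × (K i →+* ℂ)) ⊕ ((j : Fin m) × (K' j →+* ℂ))))).image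
      fun zz => (base zz.1 - base zz.2) / (((slot zz.2 : ℕ) : ℂ) - ((slot zz.1 : ℕ) : ℂ))
    with hbad₁_def
  obtain ⟨M, hM⟩ : ∃ M : ℕ, (M : ℂ) ∉ bad₁ := by
    by_contra h
    simp only [not_exists, not_not] at h
    exact Set.Infinite.mono (Set.range_subset_iff.2 fun N => (Finset.mem_coe.2 (h N)))
      (Set.infinite_range_of_injective (Nat.cast_injective (R := ℂ))) bad₁.finite_toSet
  set w : (((i : Fin n) × (K i →+* ℂ)) ⊕ ((j : Fin m) × (K' j →+* ℂ))) → ℂ := fun z =>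
    -(base z + ((slot z : ℕ) : ℂ) * M) with hw_def
  have hw : Function.Injective w := by
    intro z z' h
    have h' : base z + ((slot z : ℕ) : ℂ) * M = base z' + ((slot z' : ℕ) : ℂ) * M := by
      have h1 := h
      simp only [hw_def, neg_inj] at h1
      exact h1
    by_cases hzz : slot z = slot z'
    · refine hkey z z' hzz ?_
      rw [hzz] at h'
      exact add_right_cancel h'
    · exfalso
      apply hM
      rw [hbad₁_def, Finset.mem_image]
      refine ⟨(z, z'), Finset.mem_univ _, ?_⟩
      have hne : ((slot z' : ℕ) : ℂ) - ((slot z : ℕ) : ℂ) ≠ 0 := by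
        refine sub_ne_zero.2 fun h => hzz ?_
        exact_mod_cast h.symm
      show (base z - base z') / (((slot z' : ℕ) : ℂ) - ((slot z : ℕ) : ℂ)) = M
      rw [div_eq_iff hne]
      linear_combination h'
  -- the polynomials `pp S = ∏_{z ∈ S} (X - w z)` are pairwise distinct
  set pp : Finset ((((i : Fin n) × (K i →+* ℂ)) ⊕ ((j : Fin m) × (K' j →+* ℂ)))) → ℂ[X] :=
    fun S => ∏ z ∈ S, (X - C (w z)) with hpp_def
  have hroots : ∀ S, (pp S).roots = S.val.map w := fun S => by
    rw [hpp_def]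
    simp only
    rw [Finset.prod_eq_multiset_prod,
      show (fun z => X - C (w z)) = (fun z => X - C z) ∘ w from rfl, ← Multiset.map_map,
      Polynomial.roots_multiset_prod_X_sub_C]
  have hpinj : Function.Injective pp := fun S T h =>
    Finset.val_injective (Multiset.map_injective hw (by rw [← hroots, ← hroots, h]))
  -- avoid the finitely many bad common shifts
  set bad : Finset ℂ :=
    (Finset.univ : Finset (Finset ((((i : Fin n) × (K i →+* ℂ)) ⊕ ((j : Fin m) × (K' j →+* ℂ)))) ×
      Finset ((((i : Fin n) × (K i →+* ℂ)) ⊕ ((j : Fin m) × (K' j →+* ℂ)))))).biUnion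
      fun st => (pp st.1 - pp st.2).roots.toFinset with hbad_def
  obtain ⟨N, hN⟩ : ∃ N : ℕ, (N : ℂ) ∉ bad := by
    by_contra h
    simp only [not_exists, not_not] at h
    exact Set.Infinite.mono (Set.range_subset_iff.2 fun N => (Finset.mem_coe.2 (h N)))
      (Set.infinite_range_of_injective (Nat.cast_injective (R := ℂ))) bad.finite_toSet
  refine ⟨fun i => a₀ i + ((i : ℕ) * M + N : ℕ), fun j => a₀' j + ((n + (j : ℕ)) * M + N : ℕ),
    fun S T hST => ?_⟩
  -- the joint character of `S` at the shifted families is `(pp S)(N)`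
  have heval : ∀ S : Finset ((((i : Fin n) × (K i →+* ℂ)) ⊕ ((j : Fin m) × (K' j →+* ℂ)))),
      ∏ z ∈ S, Sum.elim
          (fun x : (i : Fin n) × (K i →+* ℂ) => x.2 (((a₀ x.1 + ((x.1 : ℕ) * M + N : ℕ) : 𝓞 (K x.1))) : K x.1))
          (fun y : (j : Fin m) × (K' j →+* ℂ) =>
            y.2 (((a₀' y.1 + ((n + (y.1 : ℕ)) * M + N : ℕ) : 𝓞 (K' y.1))) : K' y.1)) z =
        (pp S).eval (N : ℂ) := by
    intro S
    rw [hpp_def]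
    simp only
    rw [Polynomial.eval_prod]
    refine Finset.prod_congr rfl fun z _ => ?_
    rw [Polynomial.eval_sub, Polynomial.eval_X, Polynomial.eval_C, hw_def]
    rcases z with ⟨i, σ⟩ | ⟨j, σ⟩
    · simp only [Sum.elim_inl, base, slot, RingOfIntegers.coe_eq_algebraMap, map_add, map_mul,
        map_natCast, Nat.cast_add, Nat.cast_mul, sub_neg_eq_add]
      ring
    · simp only [Sum.elim_inr, base, slot, RingOfIntegers.coe_eq_algebraMap, map_add, map_mul,
        map_natCast, Nat.cast_add, Nat.cast_mul, sub_neg_eq_add]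
      ring
  have hST' : (pp S).eval (N : ℂ) = (pp T).eval (N : ℂ) := by
    rw [← heval, ← heval]
    exact hST
  by_contra hne
  have hp : pp S - pp T ≠ 0 := sub_ne_zero.2 fun h => hne (hpinj h)
  apply hN
  rw [hbad_def, Finset.mem_biUnion]
  refine ⟨(S, T), Finset.mem_univ _, ?_⟩
  rw [Multiset.mem_toFinset, Polynomial.mem_roots hp, Polynomial.IsRoot, Polynomial.eval_sub,
    sub_eq_zero]
  exact hST'

end Separating

/-! ### §2 Balanced weights of the glued CM pair split into balanced blocks -/

section Blocks

/-- Complex conjugation of `ℂ` as a ring automorphism acts on embeddings by `φ ↦ φ̄`. [folklore] -/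
private theorem starRingAut_comp_eq_conjugate {L : Type} [Field L] (φ : L →+* ℂ) :
    ((starRingAut : ℂ ≃+* ℂ) : ℂ →+* ℂ).comp φ = NumberField.ComplexEmbedding.conjugate φ :=
  RingHom.ext fun x => by rw [NumberField.ComplexEmbedding.conjugate_coe_eq]; rfl

/-- The arithmetic of the block splitting: four counting functions `α, ᾱ` (first block, inside / outside the
type) and `β, β̄` (second block) with `α + β = p = ᾱ + β̄` everywhere, a selector freezing the second block at
`1`, and an involution swapping `α(c)` with `ᾱ(1)`, force `α = ᾱ` and `β = β̄` everywhere. [folklore] -/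
private theorem blocks_arith {G : Type*} (one c : G) (sel : G → G) (α αc β βc : G → ℕ) {p N₁ N₂ : ℕ}
    (hA : ∀ τ, α τ + β τ = p) (hB : ∀ τ, αc τ + βc τ = p)
    (hsel : ∀ τ, α (sel τ) = α τ ∧ αc (sel τ) = αc τ ∧ β (sel τ) = β one ∧ βc (sel τ) = βc one)
    (hc : α c = αc one) (hN₁ : ∀ τ, α τ + αc τ = N₁) (hN₂ : ∀ τ, β τ + βc τ = N₂) :
    N₁ = 2 * α one ∧ N₂ = 2 * β one ∧ α one + β one = p ∧ ∀ τ, α τ = αc τ ∧ β τ = βc τ := by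
  have key : ∀ τ, α τ + β one = p ∧ αc τ + βc one = p := fun τ => by
    obtain ⟨e1, e2, e3, e4⟩ := hsel τ
    exact ⟨by rw [← e1, ← e3]; exact hA (sel τ), by rw [← e2, ← e4]; exact hB (sel τ)⟩
  have k1 := key one
  have kc := key c
  have a1 := hA one
  have b1 := hB one
  have n1 := hN₁ one
  have n2 := hN₂ one
  rw [hc] at kc
  refine ⟨by omega, by omega, by omega, fun τ => ?_⟩
  have kτ := key τ
  have aτ := hA τ
  have bτ := hB τ
  constructor <;> omega

/-- **Block splitting of balanced weights.**  Let `Aut(ℂ)` act blockwise independently on the embeddings of two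
families of fields `K_i`, `K'_j` carrying CM types `Φ_i`, `Φ'_j` (every `τ` agrees on all `Hom(K_i, ℂ)` with
some `τ₁` fixing all `Hom(K'_j, ℂ)`).  If a weight `S ⊆ (⊔_i Hom(K_i,ℂ)) ⊔ (⊔_j Hom(K'_j,ℂ))` satisfies
Pohlmann's condition for the glued CM pair with value `p` — for every `τ`, exactly `p` members `(k, s)` of `S`
have `τ ∘ s` inside the type and exactly `p` outside — then its two blocks are balanced weights of the two
families: `S.toLeft ∈ pohlmannSetsAlg Φ p₁`, `S.toRight ∈ pohlmannSetsAlg Φ' p₂` with `p₁ + p₂ = p`.  Proof: test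
the condition at `τ₁` (the second block then contributes its count at `τ = 1`) and at complex conjugation
(`φ ∈ Φ ↔ φ̄ ∉ Φ` swaps the two counts of the first block).  This is the weight-by-weight form of
`Hg(X × Y) = Hg(X) × Hg(Y)` for CM factors with independent Galois actions. [cite: MoonenZarhin1999LowDim, §3 (3.1)]
[cite: GaoUllmo2025, Thm. 3.1 (3.2)] -/
theorem exists_pohlmannSetsAlg_toLeft_toRight {n m : ℕ} {K : Fin n → Type} {K' : Fin m → Type}
    [∀ i, Field (K i)] [∀ j, Field (K' j)] (Φ : ∀ i, CMType (K i)) (Φ' : ∀ j, CMType (K' j))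
    (hind : ∀ τ : ℂ ≃+* ℂ, ∃ τ₁ : ℂ ≃+* ℂ,
      (∀ (i : Fin n) (s : K i →+* ℂ), (τ₁ : ℂ →+* ℂ).comp s = (τ : ℂ →+* ℂ).comp s) ∧
      ∀ (j : Fin m) (t : K' j →+* ℂ), (τ₁ : ℂ →+* ℂ).comp t = t)
    (S : Finset (((i : Fin n) × (K i →+* ℂ)) ⊕ ((j : Fin m) × (K' j →+* ℂ)))) {p : ℕ}
    (hS : ∀ τ : ℂ ≃+* ℂ,
      {z | z ∈ S ∧ Sum.elim (fun x : (i : Fin n) × (K i →+* ℂ) => (τ : ℂ →+* ℂ).comp x.2 ∈ (Φ x.1).1)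
        (fun y : (j : Fin m) × (K' j →+* ℂ) => (τ : ℂ →+* ℂ).comp y.2 ∈ (Φ' y.1).1) z}.ncard = p ∧
      {z | z ∈ S ∧ ¬ Sum.elim (fun x : (i : Fin n) × (K i →+* ℂ) => (τ : ℂ →+* ℂ).comp x.2 ∈ (Φ x.1).1)
        (fun y : (j : Fin m) × (K' j →+* ℂ) => (τ : ℂ →+* ℂ).comp y.2 ∈ (Φ' y.1).1) z}.ncard = p) :
    ∃ p₁ p₂ : ℕ, p₁ + p₂ = p ∧ S.toLeft ∈ pohlmannSetsAlg Φ p₁ ∧ S.toRight ∈ pohlmannSetsAlg Φ' p₂ := by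
  classical
  -- counting through filters
  have hnc : ∀ {γ : Type} (T : Finset γ) (Q : γ → Prop), {z | z ∈ T ∧ Q z}.ncard = (T.filter Q).card := by
    intro γ T Q
    rw [← Set.ncard_coe_finset (T.filter Q), Finset.coe_filter]
  have hsplit : ∀ Q : (((i : Fin n) × (K i →+* ℂ)) ⊕ ((j : Fin m) × (K' j →+* ℂ))) → Prop,
      {z | z ∈ S ∧ Q z}.ncard =
        {x | x ∈ S.toLeft ∧ Q (Sum.inl x)}.ncard + {y | y ∈ S.toRight ∧ Q (Sum.inr y)}.ncard := by
    intro Q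
    rw [hnc, hnc, hnc, ← Finset.card_toLeft_add_card_toRight]
    congr 2
    · ext x
      simp only [Finset.mem_toLeft, Finset.mem_filter]
    · ext y
      simp only [Finset.mem_toRight, Finset.mem_filter]
  have htot : ∀ {γ : Type} (T : Finset γ) (Q : γ → Prop),
      {z | z ∈ T ∧ Q z}.ncard + {z | z ∈ T ∧ ¬ Q z}.ncard = T.card := by
    intro γ T Q
    have hdisj : Disjoint {z | z ∈ T ∧ Q z} {z | z ∈ T ∧ ¬ Q z} :=
      Set.disjoint_left.mpr fun z hz hz' => hz'.2 hz.2
    have hunion : {z | z ∈ T ∧ Q z} ∪ {z | z ∈ T ∧ ¬ Q z} = (T : Set γ) := by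
      ext z
      simp only [Set.mem_union, Set.mem_setOf_eq, Finset.mem_coe]
      tauto
    have hfin₁ : {z | z ∈ T ∧ Q z}.Finite := T.finite_toSet.subset fun z hz => hz.1
    have hfin₂ : {z | z ∈ T ∧ ¬ Q z}.Finite := T.finite_toSet.subset fun z hz => hz.1
    rw [← Set.ncard_union_eq hdisj hfin₁ hfin₂, hunion, Set.ncard_coe_finset]
  have hrefl : ∀ {L : Type} [Field L] (t : L →+* ℂ), ((RingEquiv.refl ℂ : ℂ ≃+* ℂ) : ℂ →+* ℂ).comp t = t :=
    fun t => RingHom.ext fun _ => rfl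
  -- the arithmetic, on the four block counts
  obtain ⟨hN₁, hN₂, hp, hbal⟩ := blocks_arith (RingEquiv.refl ℂ) (starRingAut : ℂ ≃+* ℂ)
    (fun τ => (hind τ).choose)
    (fun τ => {x | x ∈ S.toLeft ∧ (τ : ℂ →+* ℂ).comp x.2 ∈ (Φ x.1).1}.ncard)
    (fun τ => {x | x ∈ S.toLeft ∧ (τ : ℂ →+* ℂ).comp x.2 ∉ (Φ x.1).1}.ncard)
    (fun τ => {y | y ∈ S.toRight ∧ (τ : ℂ →+* ℂ).comp y.2 ∈ (Φ' y.1).1}.ncard)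
    (fun τ => {y | y ∈ S.toRight ∧ (τ : ℂ →+* ℂ).comp y.2 ∉ (Φ' y.1).1}.ncard)
    (p := p) (N₁ := S.toLeft.card) (N₂ := S.toRight.card)
    (fun τ => by
      have h := (hS τ).1
      rw [hsplit] at h
      exact h)
    (fun τ => by
      have h := (hS τ).2
      rw [hsplit] at h
      exact h)
    (fun τ => by
      obtain ⟨h1, h2⟩ := (hind τ).choose_spec
      refine ⟨?_, ?_, ?_, ?_⟩
      · exact congrArg Set.ncard (Set.ext fun x => by rw [Set.mem_setOf_eq, Set.mem_setOf_eq, h1])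
      · exact congrArg Set.ncard (Set.ext fun x => by rw [Set.mem_setOf_eq, Set.mem_setOf_eq, h1])
      · exact congrArg Set.ncard (Set.ext fun y => by rw [Set.mem_setOf_eq, Set.mem_setOf_eq, h2, hrefl])
      · exact congrArg Set.ncard (Set.ext fun y => by rw [Set.mem_setOf_eq, Set.mem_setOf_eq, h2, hrefl]))
    (congrArg Set.ncard (Set.ext fun x => by
      rw [Set.mem_setOf_eq, Set.mem_setOf_eq, hrefl, starRingAut_comp_eq_conjugate]
      exact and_congr_right fun _ => iff_not_comm.1 ((Φ x.1).2 x.2)))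
    (fun τ => htot _ _) (fun τ => htot _ _)
  exact ⟨_, _, hp, ⟨hN₁, fun τ => (hbal τ).1⟩, ⟨hN₂, fun τ => (hbal τ).2⟩⟩

end Blocks

end Literature.AlgebraicGeometry.Pohlmann1968

end
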